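import Mathlib

/-!
# Federbush, *A phase cell approach to Yang–Mills theory* III — §2 «Pure Small Field Stability» (pointer), §3
# «Modifications» (modified action (3.2)–(3.4), modified distance (3.5)–(3.8)), §4 «Local Stability Statements»
# (s.f./l.f., Regimes 1–3, ΔS (4.1), Δ̃S (4.2), Local Stability Theorems 4.1–4.3) and §5.2 (5.22)–(5.25) with
# Parameter Condition 5.10: TYPED STATEMENTS with citation tags; Theorem 4.1 PROVED («it requires no proof»)

statement-level skeleton of published theorems with citation tags; proofs where landed; nothing here is a claim about the Yang–Mills mass gap

Cell `lit-balaban`, reader/typer block **r17 = Federbush**; SKELETON rows `F3-…` of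
`run/shared/lean/pub/lit-balaban/lit-balaban-r17/SKELETON-r17.md`.

**Source.** P. Federbush, *A phase cell approach to Yang–Mills theory. III. Local stability, modified renormalization
group transformation*, Commun. Math. Phys. **110** (1987) 293–309 [bib `Federbush1987PhaseCellIII`]; journal page = PDF
page + 292.  Pages READ AS IMAGES: p. 296 (§2 (2.1)–(2.5), §3 A)–B) (3.1)), p. 297 ((3.2)–(3.8), Figs. 2–4), p. 298 (§3 C)
end, §4 definitions, Regimes, (4.1)–(4.2)), p. 299 (Theorems 4.1–4.3 (4.3)–(4.5) and the «All these results will hold …»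
sentence), p. 302 ((5.17)–(5.24)), p. 303 ((5.25), Parameter Condition 5.10, «Equation (5.25) is Local Stability Theorem
4.3 with f₂ determined (as a function of N)») — renders `…/pub-balaban/t4/b2b-balaban-t4-lit2/renders/fed1987III/
fed1987-cmp110-III-p004|p006|p007|p010|p011-x2.png` and this seat's `renders/fedIII/fed1987-cmp110-III-p005-x2.png`.

**Why in the corpus.** Bałaban, CMP **102** (1985) 255–275 [`Balaban1985UV3`] p. 273: «Results related to stability bound
(70) have been obtained by P. Federbush in [17, 18]» ([18] = the preprint of this paper); the `pub-balaban` T⁴ spine's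
literature seat lists `[cite: Federbush1987PhaseCellIII, Local Stability Thm 4.3 (4.5) p. 299; (4.1)–(4.2) with Regimes
1–3 p. 298; (5.22) p. 302; (5.25) + Parameter Condition 5.10 p. 303]` as the only non-abelian d = 4 print near a one-step
averaging inequality on plaquette variables (`t4/T4-LIT2-CITABLE-NE.md` (L-14)).  §2's abelian inequality (2.1)–(2.5) is
ALREADY KERNEL-PROVED in the tree: `Federbush1986/AbelianStability.lean` (`sum_sq_weightedSum_le`,
`wilsonAction_coarse_le_fine`, `wilsonAction_torusLoopAverage_le`, …) — not restated here.

**How the setting is typed (abstraction note for the referee, F6).**  The printed objects — Federbush's MODIFIED block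
average of the level-(r+1) bond variables in the four `N⁴` blocks at the vertices of a level-r plaquette `P` (§3 C),
(3.5)–(3.8) and the Appendix «Field Dependent Contour Selection», which print itself calls «not complete, but sufficiently
specified to yield our present result», p. 294), the resulting coarse plaquette variable `A_{∂P}`, the fine plaquette
variables `A_{∂p_j}`, `j ∈ P` («exactly those plaquettes {p_i}_{i∈P} in the level r + 1 all of whose vertices lie in the
four N⁴ size blocks, vertices of the plaquette P», p. 298), and the redistributed large-field action `A_{l.f.}(P)` — are
carried by the structure `TwoLevelScheme`: a configuration type `Cfg` and, per configuration, the SIZES `|A_{∂P}| ≥ 0`,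
`|A_{∂p_j}| ≥ 0` and `A_{l.f.}(P) ≥ 0` (a function of the threshold `a`, since which plaquettes are l.f. depends on `a`),
together with the weights `α_j ≥ 0`, `Σ_j α_j = N²` of §2 (2.1)/(2.3) for `P_i = P` («We now use the definitions of Sect. 2
for α_j(P_i = P)», p. 298) and the chosen modified action profile `f_s` of (3.3)–(3.4).  Every theorem of §4 involves the
configuration ONLY through these sizes, so nothing printed is lost in the STATEMENTS; what is hidden in the carrier is
the CONSTRUCTION of the map configuration ↦ sizes (Federbush's modified averaging), which is where the content of Theorems
4.2–4.3 lives: `LocalStabilityTheorem42 S` and `LocalStabilityTheorem43 S` are predicates on a scheme `S`, and print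
asserts them for HIS scheme «for suitable fixed N, c_d, f₁, f₂, and a₀, where a must satisfy a < a₀» (p. 299) — that
scheme is not constructed in this file (SKELETON status of its construction: absent).  Theorem 4.1, by contrast, holds
for EVERY scheme and is proved here (`localStabilityTheorem41`), exactly as print says: «immediate from the definitions of
S_M, α_j, and Regime 3; it requires no proof».  (5.22)–(5.24) are typed over a separate small carrier
`AxialGaugeLinearisation` (Lie-algebra-valued bond and plaquette variables in a complete axial gauge).

## Versions
- v1 (p239010, ACCEPTED): statements as above.
- **v1.1 ERRATUM (p243556, ACCEPTED).**  In v1 the two smoothness fields read `ContDiffOn ℝ ⊤ f (Set.Ioi 0)`; in current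
  Mathlib `⊤ : WithTop ℕ∞` is `ω` = real-ANALYTIC, not `∞` = C^∞.  An analytic function on the connected open half-line
  that equals `t²` (resp. `t`) near `0⁺` equals it everywhere (identity theorem), so it cannot reach the printed plateau:
  for `a ≠ 0` the v1 carriers `ModifiedActionProfile a`, `ModifiedDistanceProfile s` were EMPTY, hence `TwoLevelScheme`
  (`a_pos`, `fs`) was empty and the typed Theorems 4.1–4.3 / (5.25) / PC 5.10 quantified over an empty type (vacuous).
  Print says «C^∞» ((3.4), (3.7) p. 297): the fields now read `ContDiffOn ℝ ∞ f (Set.Ioi 0)` — the ONLY change to an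
  existing declaration (same names, same docstrings otherwise) — and the carriers are shown INHABITED:
  `ModifiedActionProfile.standard a` (0 < a), `ModifiedDistanceProfile.standard s` (0 < s) built from
  `Real.smoothTransition` with every field PROVED, and the toy scheme `TwoLevelScheme.toy` (one fine plaquette, zero
  field sizes — a consistency witness for the carrier, NOT Federbush's scheme).  Found by the author (r17) while writing the
  non-vacuity witnesses the reviewer of p239010 advised.
- **v1.2 (this version) — docstring ERRATUM on `AxialGaugeLinearisation.Eq524` only; NO declaration changed.**  Phase 2
  (unit `lit-balaban-p32` gen 4, `Federbush1986/AxialGaugeEq524SU2.lean`, p248407) showed that (5.24) with the PRINTED strict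
  `<` is unsatisfiable at the zero field whenever a free bond exists (`AxialGaugeLinearisation.not_eq524_of_plaq_eq_zero`) and
  vendored the non-strict reading `AxialGaugeLinearisation.Eq524Le` as the statement of record (proved there for the `SU(2)`
  comb-gauge strip instance).  The docstring of `Eq524` now records this (row F3.Eq5.24; GAPS G-F3-p32-02); the definition is
  kept verbatim as the subject of the refutation theorem.
-/

namespace Literature.MathematicalPhysics.QuantumFieldTheory.Federbush1986

noncomputable section

open scoped BigOperators ContDiff

/-! ## §3 B) — the modified action profile `f_s` (3.3)–(3.4) and C) the modified distance profile `f_d` (3.5)–(3.7) -/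

/-- «S_M(P) = f_s(A_{∂P}), (3.3) where f_s(A) = f_s(|A|) is C^∞ and monotonic in |A|, and satisfies f_s(A) = |A|² if
|A| ≤ a, 3/2a² if |A| ≥ 2a. (3.4) (a will be small.)» — a profile `f : ℝ → ℝ` of the size `t = |A| ≥ 0` with the printed
properties (smoothness on the open half-line `t > 0` is what «C^∞ in |A|» can mean at the level of sizes; we record `C^∞`
on all of `ℝ` of the even extension is NOT required — READING, weaker-than-print: `ContDiffOn ℝ ∞ f (Set.Ioi 0)`, `∞` = C^∞;
v1 wrote `⊤` = C^ω here, ERRATUM v1.1, see the module docstring).  Inhabited: `ModifiedActionProfile.standard`.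
[cite: Federbush1987PhaseCellIII, (3.3)–(3.4) p. 297] -/
structure ModifiedActionProfile (a : ℝ) where
  /-- the profile `t ↦ f_s` on sizes `t = |A|` -/
  f : ℝ → ℝ
  /-- «C^∞» (on `t > 0`) -/
  smooth : ContDiffOn ℝ ∞ f (Set.Ioi 0)
  /-- «monotonic in |A|» -/
  mono : MonotoneOn f (Set.Ici 0)
  /-- «f_s(A) = |A|² if |A| ≤ a» -/
  eq_sq : ∀ t, 0 ≤ t → t ≤ a → f t = t ^ 2
  /-- «3/2 a² if |A| ≥ 2a» -/
  eq_plateau : ∀ t, 2 * a ≤ t → f t = 3 / 2 * a ^ 2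

namespace ModifiedActionProfile

variable {a : ℝ} (F : ModifiedActionProfile a)

/-- Consequence of (3.4) + monotonicity: `0 ≤ f_s(t)` for `t ≥ 0` (when `a ≥ 0`). [cite: Federbush1987PhaseCellIII,
(3.4) p. 297] -/
theorem f_nonneg (ha : 0 ≤ a) {t : ℝ} (ht : 0 ≤ t) : 0 ≤ F.f t := by
  have h0 : F.f 0 = 0 := by rw [F.eq_sq 0 le_rfl ha]; ring
  rw [← h0]
  exact F.mono (Set.mem_Ici.mpr le_rfl) (Set.mem_Ici.mpr ht) ht

/-- Consequence of (3.4) + monotonicity: `f_s(t) ≤ 3/2 a²` for `t ≥ 0` — the plateau bounds the modified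
action (Fig. 3). [cite: Federbush1987PhaseCellIII, (3.4) and Fig. 3 p. 297] -/
theorem f_le_plateau {t : ℝ} (ht : 0 ≤ t) : F.f t ≤ 3 / 2 * a ^ 2 := by
  by_cases h : 2 * a ≤ t
  · rw [F.eq_plateau t h]
  · have h : t < 2 * a := not_le.mp h
    have h2a : 0 ≤ 2 * a := by linarith
    calc F.f t ≤ F.f (2 * a) := F.mono (Set.mem_Ici.mpr ht) (Set.mem_Ici.mpr h2a) h.le
      _ = 3 / 2 * a ^ 2 := F.eq_plateau _ le_rfl

end ModifiedActionProfile

/-- «C) Averaging. We modify d(e^A, e^B) to d_M(e^A, e^B) also an invariant distance with d_M(ε, e^A) = f_d(|A|), (3.5)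
where |A| is chosen small for elements close to ε. We choose f_d(|A|) = |A| for |A| < c_dN²a, (3/2)(c_dN²a) for
|A| > 2c_dN²a (3.6) and require f_d to be C^∞ with bounds on its derivatives |f_d^{(r)}| < c_r(c_dN²a)^{−r}, (3.7)» —
the profile of the modified distance (the average `ḡ` is then «chosen by minimizing Σ_1^n d_M²(ḡ, g_i) (3.8) as a
variation of (1.2)», p. 297–298).  Typed with the scale `s = c_d N² a` as a parameter; (3.7) for every order `r ≥ 1`
with constants `c_r` (on `t > 0`). [cite: Federbush1987PhaseCellIII, (3.5)–(3.7) p. 297] -/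
structure ModifiedDistanceProfile (s : ℝ) where
  /-- the profile `t ↦ f_d(t)` on sizes `t = |A| ≥ 0` -/
  f : ℝ → ℝ
  /-- «C^∞» (on `t > 0`) -/
  smooth : ContDiffOn ℝ ∞ f (Set.Ioi 0)
  /-- «f_d(|A|) = |A| for |A| < c_dN²a» -/
  eq_id : ∀ t, 0 ≤ t → t < s → f t = t
  /-- «(3/2)(c_dN²a) for |A| > 2c_dN²a» -/
  eq_plateau : ∀ t, 2 * s < t → f t = 3 / 2 * s
  /-- «|f_d^{(r)}| < c_r (c_dN²a)^{−r} (3.7)» -/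
  deriv_bound : ∀ r : ℕ, 1 ≤ r → ∃ c_r : ℝ, ∀ t, 0 < t → |iteratedDeriv r f t| < c_r * s⁻¹ ^ r


/-! ### v1.1 — the carriers of §3 B), C) are inhabited (explicit C^∞ profiles from `Real.smoothTransition`) -/

namespace ModifiedActionProfile

/-- An explicit profile with the printed properties (3.4): `t² + S(5(t − a)/a)·(3/2·a² − t²)`, `S` Mathlib's
`Real.smoothTransition` (C^∞, monotone, `0` on `t ≤ a`, `1` on `t ≥ 6a/5`); the transition is completed at `6a/5`, where
`t² ≤ 36/25·a² < 3/2·a²`, which makes the profile monotone. [cite: Federbush1987PhaseCellIII, (3.4) and Fig. 3 p. 297] -/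
def standardFun (a t : ℝ) : ℝ :=
  t ^ 2 + Real.smoothTransition (5 * (t - a) / a) * (3 / 2 * a ^ 2 - t ^ 2)

/-- `standardFun a` is C^∞ on `ℝ`. [cite: Federbush1987PhaseCellIII, (3.4) p. 297] -/
theorem contDiff_standardFun (a : ℝ) : ContDiff ℝ ∞ (standardFun a) := by
  unfold standardFun
  exact (contDiff_id.pow 2).add
    ((Real.smoothTransition.contDiff.comp
      ((contDiff_const.mul (contDiff_id.sub contDiff_const)).div_const a)).mul
      (contDiff_const.sub (contDiff_id.pow 2)))

/-- For `0 < a`, the explicit profile is a `ModifiedActionProfile a` (every printed property PROVED; in particular the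
carrier is non-empty). [cite: Federbush1987PhaseCellIII, (3.3)–(3.4) p. 297] -/
def standard (a : ℝ) (ha : 0 < a) : ModifiedActionProfile a where
  f := standardFun a
  smooth := (contDiff_standardFun a).contDiffOn
  mono := by
    intro t₁ ht₁ t₂ _ h12
    simp only [Set.mem_Ici] at ht₁
    simp only [standardFun]
    set S₁ := Real.smoothTransition (5 * (t₁ - a) / a) with hS₁
    set S₂ := Real.smoothTransition (5 * (t₂ - a) / a) with hS₂
    by_cases h1 : t₁ ≤ 6 / 5 * a
    · have hK : t₁ ^ 2 ≤ 3 / 2 * a ^ 2 := by nlinarith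
      have hS12 : S₁ ≤ S₂ :=
        Real.smoothTransition.monotone (by
          apply div_le_div_of_nonneg_right _ ha.le
          linarith)
      have hS2le : S₂ ≤ 1 := Real.smoothTransition.le_one _
      have hsq : t₁ ^ 2 ≤ t₂ ^ 2 := by nlinarith
      nlinarith [mul_nonneg (sub_nonneg.mpr hS2le) (sub_nonneg.mpr hsq),
        mul_nonneg (sub_nonneg.mpr hS12) (sub_nonneg.mpr hK)]
    · have h1 : 6 / 5 * a < t₁ := not_le.mp h1
      have h1' : (1 : ℝ) ≤ 5 * (t₁ - a) / a := by
        rw [le_div_iff₀ ha]; linarith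
      have h2' : (1 : ℝ) ≤ 5 * (t₂ - a) / a := by
        rw [le_div_iff₀ ha]; linarith
      have e1 : S₁ = 1 := Real.smoothTransition.one_of_one_le h1'
      have e2 : S₂ = 1 := Real.smoothTransition.one_of_one_le h2'
      rw [e1, e2]
      linarith
  eq_sq := by
    intro t _ hta
    have h : 5 * (t - a) / a ≤ 0 := div_nonpos_of_nonpos_of_nonneg (by linarith) ha.le
    simp [standardFun, Real.smoothTransition.zero_of_nonpos h]
  eq_plateau := by
    intro t ht
    have h : (1 : ℝ) ≤ 5 * (t - a) / a := by rw [le_div_iff₀ ha]; linarith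
    simp [standardFun, Real.smoothTransition.one_of_one_le h]

end ModifiedActionProfile

namespace ModifiedDistanceProfile

/-- An explicit profile with the printed properties (3.6)–(3.7): `t + S(4(t − s)/s)·(3/2·s − t)` (transition completed at
`5s/4 < 3s/2`). [cite: Federbush1987PhaseCellIII, (3.6) p. 297] -/
def standardFun (s t : ℝ) : ℝ :=
  t + Real.smoothTransition (4 * (t - s) / s) * (3 / 2 * s - t)

/-- `standardFun s` is C^∞ on `ℝ`. [cite: Federbush1987PhaseCellIII, (3.7) p. 297] -/
theorem contDiff_standardFun (s : ℝ) : ContDiff ℝ ∞ (standardFun s) := by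
  unfold standardFun
  exact contDiff_id.add
    ((Real.smoothTransition.contDiff.comp
      ((contDiff_const.mul (contDiff_id.sub contDiff_const)).div_const s)).mul
      (contDiff_const.sub contDiff_id))

/-- Beyond `2s` the explicit profile is the constant `3/2·s` (for `0 < s`). [cite: Federbush1987PhaseCellIII, (3.6)
p. 297] -/
theorem standardFun_of_gt {s : ℝ} (hs : 0 < s) {t : ℝ} (ht : 2 * s < t) : standardFun s t = 3 / 2 * s := by
  have h : (1 : ℝ) ≤ 4 * (t - s) / s := by rw [le_div_iff₀ hs]; linarith
  simp [standardFun, Real.smoothTransition.one_of_one_le h]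

/-- For `0 < s`, the explicit profile is a `ModifiedDistanceProfile s`: (3.6) by the support properties of
`Real.smoothTransition`, and (3.7) — with constants `c_r` depending on `r` (and, as the field allows, on `s`) — because
every derivative of order `r ≥ 1` is continuous, vanishes beyond `2s` (the profile is locally constant there) and is
therefore bounded on `t > 0` by its maximum over `[0, 3s]` (so the carrier is non-empty). [cite: Federbush1987PhaseCellIII,
(3.5)–(3.7) p. 297] -/
def standard (s : ℝ) (hs : 0 < s) : ModifiedDistanceProfile s where
  f := standardFun s
  smooth := (contDiff_standardFun s).contDiffOn
  eq_id := by
    intro t _ hts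
    have h : 4 * (t - s) / s ≤ 0 := div_nonpos_of_nonpos_of_nonneg (by linarith) hs.le
    simp [standardFun, Real.smoothTransition.zero_of_nonpos h]
  eq_plateau := fun t ht => standardFun_of_gt hs ht
  deriv_bound := by
    intro r hr
    have hcont : Continuous (iteratedDeriv r (standardFun s)) :=
      (contDiff_standardFun s).continuous_iteratedDeriv r (by exact_mod_cast le_top)
    obtain ⟨M, hM⟩ := (isCompact_Icc (a := (0 : ℝ)) (b := 3 * s)).exists_bound_of_continuousOn hcont.continuousOn
    refine ⟨(|M| + 1) * s ^ r, fun t ht => ?_⟩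
    have hsr : (|M| + 1) * s ^ r * s⁻¹ ^ r = |M| + 1 := by
      rw [mul_assoc, ← mul_pow, mul_inv_cancel₀ hs.ne', one_pow, mul_one]
    rw [hsr]
    by_cases h3 : t ≤ 3 * s
    · have := hM t ⟨ht.le, h3⟩
      rw [Real.norm_eq_abs] at this
      linarith [le_abs_self M]
    · have h3 : 3 * s < t := not_le.mp h3
      have hev : (standardFun s) =ᶠ[nhds t] fun _ => 3 / 2 * s := by
        have hopen : IsOpen (Set.Ioi (2 * s)) := isOpen_Ioi
        filter_upwards [hopen.mem_nhds (show t ∈ Set.Ioi (2 * s) by simp only [Set.mem_Ioi]; linarith)] with u hu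
        exact standardFun_of_gt hs hu
      rw [hev.iteratedDeriv_eq r]
      have hr0 : r ≠ 0 := by omega
      simp [iteratedDeriv_const, hr0]
      positivity

end ModifiedDistanceProfile

/-! ## §4 — the two-level scheme, s.f./l.f., Regimes 1–3, ΔS (4.1), Δ̃S (4.2) -/

/-- The carrier of §4 (see the module docstring, F6): for one level-r plaquette `P`, block side `N`, the finite index
type `J` of the fine plaquettes `p_j`, `j ∈ P`, the weights `α_j` of §2 for `P_i = P` with (2.3) `Σ_j α_j = N²` and
«non-negative numbers α(i)_j» (2.1), a configuration type, and per configuration the sizes `|A_{∂P}|`, `|A_{∂p_j}|`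
(«A plaquette p is s.f. if |A_{∂p}| < a (more properly, |g_{∂p}| < a …)», p. 298) and the redistributed action
`A_{l.f.}(P)` («If one half the action, ½a², of a l.f. plaquette is distributed equally among all the plaquettes it hits,
A_{l.f.}(p) is the action associated to p by this process», p. 298 — a function of the threshold `a`), and the chosen
modified action profile `f_s` (3.3)–(3.4) at threshold `a`.  HIDDEN in the carrier: Federbush's modified averaging
configuration ↦ `A_{∂P}` (§3 C) + Appendix) and the «hit» combinatorics defining `A_{l.f.}`.
[cite: Federbush1987PhaseCellIII, §4 p. 298; (2.1), (2.3) p. 296; (3.3)–(3.4) p. 297] -/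
structure TwoLevelScheme where
  /-- block side «N⁴ instead of 2⁴» (§3 A) -/
  N : ℕ
  /-- the small-field threshold `a` of §4 -/
  a : ℝ
  a_pos : 0 < a
  /-- index type of the fine plaquettes `p_j`, `j ∈ P` -/
  J : Type
  [fintypeJ : Fintype J]
  /-- the weights `α_j = α(i)_j` of (2.1) for `P_i = P` -/
  α : J → ℝ
  α_nonneg : ∀ j, 0 ≤ α j
  /-- (2.3) «Σ_j α(i)_j = N²» -/
  sum_α : ∑ j, α j = (N : ℝ) ^ 2
  /-- level-(r+1) bond configurations in the four blocks -/
  Cfg : Type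
  /-- `|A_{∂P}|` of the configuration (via the modified block average) -/
  coarse : Cfg → ℝ
  coarse_nonneg : ∀ u, 0 ≤ coarse u
  /-- `|A_{∂p_j}|` -/
  fine : Cfg → J → ℝ
  fine_nonneg : ∀ u j, 0 ≤ fine u j
  /-- `A_{l.f.}(P)` -/
  Alf : Cfg → ℝ
  Alf_nonneg : ∀ u, 0 ≤ Alf u
  /-- the modified action profile `f_s` at threshold `a` -/
  fs : ModifiedActionProfile a

attribute [instance] TwoLevelScheme.fintypeJ

/-- v1.1: a TOY inhabitant of the carrier (consistency witness only — NOT Federbush's scheme): block side `N = 1`, one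
fine plaquette with weight `α = 1 = N²` ((2.3)), one configuration with all sizes `0`, and the explicit profile
`ModifiedActionProfile.standard a`. [cite: Federbush1987PhaseCellIII, §4 p. 298; (2.3) p. 296] -/
def TwoLevelScheme.toy (a : ℝ) (ha : 0 < a) : TwoLevelScheme where
  N := 1
  a := a
  a_pos := ha
  J := Unit
  α := fun _ => 1
  α_nonneg := fun _ => zero_le_one
  sum_α := by simp
  Cfg := Unit
  coarse := fun _ => 0
  coarse_nonneg := fun _ => le_rfl
  fine := fun _ _ => 0
  fine_nonneg := fun _ _ => le_rfl
  Alf := fun _ => 0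
  Alf_nonneg := fun _ => le_rfl
  fs := ModifiedActionProfile.standard a ha

namespace TwoLevelScheme

variable (S : TwoLevelScheme)

/-- «A plaquette p is s.f. if |A_{∂p}| < a». [cite: Federbush1987PhaseCellIII, §4 p. 298] -/
def sf (u : S.Cfg) (j : S.J) : Prop := S.fine u j < S.a

/-- «and l.f. if |A_{∂p}| ≥ a». [cite: Federbush1987PhaseCellIII, §4 p. 298] -/
def lf (u : S.Cfg) (j : S.J) : Prop := S.a ≤ S.fine u j

/-- s.f. is decidable (a real inequality; classical). [cite: Federbush1987PhaseCellIII, §4 p. 298] -/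
instance instDecidableSf (u : S.Cfg) (j : S.J) : Decidable (S.sf u j) := by unfold sf; infer_instance

/-- «Regime 1. All the p_i (p_i with i ∈ P) are s.f..» [cite: Federbush1987PhaseCellIII, §4 p. 298] -/
def Regime1 (u : S.Cfg) : Prop := ∀ j, S.sf u j

/-- «Regime 2. Some of the p_i are l.f., but A_{l.f.}(P) < 3a².» [cite: Federbush1987PhaseCellIII, §4 p. 298] -/
def Regime2 (u : S.Cfg) : Prop := (∃ j, S.lf u j) ∧ S.Alf u < 3 * S.a ^ 2

/-- «Regime 3. A_{l.f.}(P) ≥ 3a².» [cite: Federbush1987PhaseCellIII, §4 p. 298] -/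
def Regime3 (u : S.Cfg) : Prop := 3 * S.a ^ 2 ≤ S.Alf u

/-- The modified action of the coarse plaquette «S_M(P) = f_s(A_{∂P}) (3.3)». [cite: Federbush1987PhaseCellIII, (3.3)
p. 297] -/
def SMcoarse (u : S.Cfg) : ℝ := S.fs.f (S.coarse u)

/-- The modified action of a fine plaquette `S_M(p_j) = f_s(A_{∂p_j})`. [cite: Federbush1987PhaseCellIII, (3.3) p. 297] -/
def SMfine (u : S.Cfg) (j : S.J) : ℝ := S.fs.f (S.fine u j)

/-- «ΔS(P) = N² Σ_j α_j S_M(p_j) − S_M(P). (4.1) (See [3, Sect. 2.4].)» [cite: Federbush1987PhaseCellIII, (4.1) p. 298] -/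
def deltaS (u : S.Cfg) : ℝ := (S.N : ℝ) ^ 2 * ∑ j, S.α j * S.SMfine u j - S.SMcoarse u

/-- «Δ̃S(P) = A_{l.f.}(P) + N² Σ_{j ≠ l.f.} α_j S_M(p_j) − S_M(P). (4.2) The sum in (4.2) is over plaquettes p_j that are
s.f.» [cite: Federbush1987PhaseCellIII, (4.2) p. 298] -/
def deltaStilde (u : S.Cfg) : ℝ :=
  S.Alf u + (S.N : ℝ) ^ 2 * ∑ j ∈ Finset.univ.filter (fun j => S.sf u j), S.α j * S.SMfine u j - S.SMcoarse u

/-! ## §4 — Local Stability Theorems 4.1 (proved), 4.2, 4.3; §5.2 (5.25) and Parameter Condition 5.10 -/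

/-- **Local Stability Theorem 4.1.** «In Regime 3, Δ̃S(P) ≥ a². (4.3) This theorem is immediate from the definitions of
S_M, α_j, and Regime 3; it requires no proof.» — PROVED for every scheme: `A_{l.f.}(P) ≥ 3a²`, the s.f. sum is `≥ 0`
(`α_j ≥ 0`, `f_s ≥ 0`), and `S_M(P) = f_s(|A_{∂P}|) ≤ 3/2 a²` by (3.4), so `Δ̃S(P) ≥ 3a² − 3/2 a² ≥ a²`.
[cite: Federbush1987PhaseCellIII, Local Stability Theorem 4.1 (4.3) p. 299] -/
theorem localStabilityTheorem41 (u : S.Cfg) (h3 : S.Regime3 u) : S.a ^ 2 ≤ S.deltaStilde u := by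
  have ha : 0 ≤ S.a := S.a_pos.le
  have hsum : 0 ≤ (S.N : ℝ) ^ 2 * ∑ j ∈ Finset.univ.filter (fun j => S.sf u j), S.α j * S.SMfine u j := by
    apply mul_nonneg (by positivity)
    apply Finset.sum_nonneg
    intro j _
    exact mul_nonneg (S.α_nonneg j) (S.fs.f_nonneg ha (S.fine_nonneg u j))
  have hP : S.SMcoarse u ≤ 3 / 2 * S.a ^ 2 := S.fs.f_le_plateau (S.coarse_nonneg u)
  unfold Regime3 at h3
  unfold deltaStilde
  nlinarith [sq_nonneg S.a]

/-- **Local Stability Theorem 4.2.** «There is a number f₁ > 0 such that in Regime 2, Δ̃S(P) ≥ f₁a². (4.4)» with «All these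
results will hold for suitable fixed N, c_d, f₁, f₂, and a₀, where a must satisfy a < a₀.» (p. 299).  TYPED as a predicate
on a FAMILY of schemes `S a` indexed by the threshold `a` (N, c_d and the modified averaging fixed inside): `f₁ > 0` and
`a₀ > 0` are chosen first, then every `a < a₀` and every configuration in Regime 2.  Print asserts it for Federbush's
modified averaging (§3 C) + Appendix) «for N large enough, and a₀ small enough depending on N» (§5.3 p. 303; proof §5.3
pp. 303–305, «complicated and tricky, but mushy»). [cite: Federbush1987PhaseCellIII, Local Stability Theorem 4.2 (4.4)
p. 299; §5.3 pp. 303–305] -/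
def LocalStabilityTheorem42 (S : ℝ → TwoLevelScheme) : Prop :=
  ∃ f₁ > (0 : ℝ), ∃ a₀ > (0 : ℝ), ∀ a : ℝ, 0 < a → a < a₀ → (S a).a = a ∧
    ∀ u : (S a).Cfg, (S a).Regime2 u → f₁ * a ^ 2 ≤ (S a).deltaStilde u

/-- **Local Stability Theorem 4.3.** «There is a number f₂ such that in Regime 1, Δ̃S(P) ≥ −f₂(Σ|A_{∂p_j}|²)^{3/2}. (4.5)»
(same «suitable fixed N, c_d, f₁, f₂, and a₀, where a must satisfy a < a₀» clause; «Equation (5.25) below is actually a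
stronger form of Local Stability Theorem 4.3 that is needed for applications.»).  TYPED as for Theorem 4.2.
[cite: Federbush1987PhaseCellIII, Local Stability Theorem 4.3 (4.5) p. 299] -/
def LocalStabilityTheorem43 (S : ℝ → TwoLevelScheme) : Prop :=
  ∃ f₂ : ℝ, ∃ a₀ > (0 : ℝ), ∀ a : ℝ, 0 < a → a < a₀ → (S a).a = a ∧
    ∀ u : (S a).Cfg, (S a).Regime1 u →
      -f₂ * (∑ j, (S a).fine u j ^ 2) ^ ((3 : ℝ) / 2) ≤ (S a).deltaStilde u

/-- **(5.25)** «d) For a small enough (depending on N) we find from Baker–Campbell–Hausdorff estimates the basic result: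
|A_{∂P}|² ≤ N² Σ_j α_j|A_{∂p_j}|² + c(Σ|A_{∂p_j}|²)^{3/2}. (5.25)» — in Regime 1 («We now specialize to the situation
where all p_i are s.f.», p. 301), in a Bałaban axial gauge (p. 302; the sizes are gauge invariant), for Federbush's block
average with the weights `α_j` of (5.21).  TYPED at fixed `N` as a predicate on the `a`-family of schemes: `∃ c, ∃ a₀ > 0,
∀ a < a₀`.  «The right side [of (5.22)] is the first term in a power series convergent for small fields», the derivation of
(5.25) is asserted, not displayed. [cite: Federbush1987PhaseCellIII, (5.25) p. 303; Steps 1–4 (5.17)–(5.21) p. 302] -/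
def Eq525 (S : ℝ → TwoLevelScheme) : Prop :=
  ∃ c : ℝ, ∃ a₀ > (0 : ℝ), ∀ a : ℝ, 0 < a → a < a₀ → (S a).a = a ∧
    ∀ u : (S a).Cfg, (S a).Regime1 u →
      (S a).coarse u ^ 2 ≤ ((S a).N : ℝ) ^ 2 * ∑ j, (S a).α j * (S a).fine u j ^ 2
        + c * (∑ j, (S a).fine u j ^ 2) ^ ((3 : ℝ) / 2)

/-- **Parameter Condition 5.10.** «a₀ is picked small enough (as a function of N) such that (5.25) holds.» — i.e. the
`a₀` of `Eq525`; recorded as the statement that such an `a₀` works for the family. «Equation (5.25) is Local Stability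
Theorem 4.3 with f₂ determined (as a function of N).» [cite: Federbush1987PhaseCellIII, Parameter Condition 5.10 p. 303] -/
def ParameterCondition510 (S : ℝ → TwoLevelScheme) (a₀ : ℝ) : Prop :=
  0 < a₀ ∧ ∃ c : ℝ, ∀ a : ℝ, 0 < a → a < a₀ → (S a).a = a ∧
    ∀ u : (S a).Cfg, (S a).Regime1 u →
      (S a).coarse u ^ 2 ≤ ((S a).N : ℝ) ^ 2 * ∑ j, (S a).α j * (S a).fine u j ^ 2
        + c * (∑ j, (S a).fine u j ^ 2) ^ ((3 : ℝ) / 2)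

/-- Bookkeeping: Parameter Condition 5.10 at some `a₀` is exactly (5.25) for the family. [cite: Federbush1987PhaseCellIII,
Parameter Condition 5.10 and (5.25) p. 303] -/
theorem eq525_iff_exists_parameterCondition510 (S : ℝ → TwoLevelScheme) :
    Eq525 S ↔ ∃ a₀, ParameterCondition510 S a₀ := by
  constructor
  · rintro ⟨c, a₀, ha₀, h⟩
    exact ⟨a₀, ha₀, c, h⟩
  · rintro ⟨a₀, ha₀, c, h⟩
    exact ⟨c, a₀, ha₀, h⟩

end TwoLevelScheme

/-! ## §5.2 — the small-field linearisation (5.22)–(5.24) in a complete (Bałaban) axial gauge -/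

/-- Carrier for (5.22)–(5.24) (F6): Lie-algebra-valued fine plaquette variables `A_{∂p_i}`, `i ∈ I`, and bond variables
`A_{b_α}` for the bonds `α ∈ B` «not assigned ε by the gauge» of the level-(r+1) lattice portion, as functions of a
configuration, with the printed matrices `M_{iα}` (5.22) and `N_{αi}` (5.23) («with A_{∂p_i}, i ∈ J, a linearly
independent set»).  HIDDEN: the lattice portion (four `N⁴` blocks), the axial gauge, and that `A_{∂p}`/`A_b` are the
logarithms of the group-valued variables. [cite: Federbush1987PhaseCellIII, (5.22)–(5.23) p. 302] -/
structure AxialGaugeLinearisation (𝔤 : Type) [NormedAddCommGroup 𝔤] [NormedSpace ℝ 𝔤] where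
  /-- fine plaquettes (a linearly independent set `J` of them, print's `i ∈ J`) -/
  I : Type
  [fintypeI : Fintype I]
  /-- bonds not fixed to `ε` by the axial gauge -/
  B : Type
  [fintypeB : Fintype B]
  /-- configurations -/
  Cfg : Type
  /-- `A_{∂p_i}` -/
  plaq : Cfg → I → 𝔤
  /-- `A_{b_α}` -/
  bond : Cfg → B → 𝔤
  /-- `M_{iα}` of (5.22) -/
  M : I → B → ℝ
  /-- `N_{αi}` of (5.23) -/
  Nmat : B → I → ℝ

attribute [instance] AxialGaugeLinearisation.fintypeI AxialGaugeLinearisation.fintypeB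

/-- v1.1: a TOY inhabitant of the (5.22)–(5.24) carrier (consistency witness only): no plaquettes, no free bonds, one
configuration, `𝔤 = ℝ`. [cite: Federbush1987PhaseCellIII, (5.22)–(5.23) p. 302] -/
def AxialGaugeLinearisation.toy : AxialGaugeLinearisation ℝ where
  I := PEmpty
  B := PEmpty
  Cfg := Unit
  plaq := fun _ i => i.elim
  bond := fun _ b => b.elim
  M := fun i _ => i.elim
  Nmat := fun b _ => b.elim

namespace AxialGaugeLinearisation

variable {𝔤 : Type} [NormedAddCommGroup 𝔤] [NormedSpace ℝ 𝔤] (L : AxialGaugeLinearisation 𝔤)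

/-- **(5.24)** «By the inverse function theorem we have for A_{∂p_i} small enough (depending on N),
|A_{b_α} − Σ_i N_{αi}A_{∂p_i}| < cΣ|A_{∂p_i}|². (5.24)» — with (5.22) «A_{∂p_i} = Σ_α M_{iα}A_{b_α}» as «the first term in
a power series convergent for small fields» and (5.23) «A_{b_α} = Σ_{i∈J} N_{αi}A_{∂p_i}» its small-field inverse («Since
the Balaban gauge provides a complete gauge specification»).  TYPED: `∃ c, ∃ ρ > 0` (ρ «depending on N»), for every
configuration with all `|A_{∂p_i}| < ρ`.  **ERRATUM v1.2 (row F3.Eq5.24; GAPS G-F3-p32-02, unit `lit-balaban-p32` gen 4):** with the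
PRINTED STRICT `<` this predicate is UNSATISFIABLE for every carrier having a free bond and a configuration whose plaquette
variables all vanish (e.g. the identity field: the conclusion then reads `‖A_{b_α}‖ < c·0`) — refuted by
`AxialGaugeLinearisation.not_eq524_of_plaq_eq_zero` (`Federbush1986/AxialGaugeEq524SU2.lean`, p248407); the statement of
record for consumers is the NON-STRICT reading `AxialGaugeLinearisation.Eq524Le` (ibid.; `eq524Le_of_eq524 : Eq524 → Eq524Le`),
proved there for the `SU(2)` comb-gauge strip model instance (`CombGauge.eq524Le_combStrip`).  `Eq524` is kept verbatim (it is
the subject of the refutation theorem). [cite: Federbush1987PhaseCellIII, (5.22)–(5.24) p. 302] -/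
def Eq524 : Prop :=
  ∃ c : ℝ, ∃ ρ > (0 : ℝ), ∀ u : L.Cfg, (∀ i, ‖L.plaq u i‖ < ρ) →
    ∀ α : L.B, ‖L.bond u α - ∑ i, L.Nmat α i • L.plaq u i‖ < c * ∑ i, ‖L.plaq u i‖ ^ 2

end AxialGaugeLinearisation

end

end Literature.MathematicalPhysics.QuantumFieldTheory.Federbush1986
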